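import Literature.IUT.LogVolume.WildShellObstruction
import Literature.IUT.LogVolume.PadicSubfields
import HarnessLib

/-!
# Non-vacuity of the wild-shell obstruction: `ℚ₃(∛3) ⊆ ℚ̄₃` is an instance

`WildShellObstruction.lean` proves, for EVERY field `K ⊇ ℚ₃` with `[K : ℚ₃] = 3` and `π ∈ K`, `π³ = 3`
(carrying the cell's four instances `NontriviallyNormedField`, `NormedAlgebra ℚ₃`, `IsUltrametricDist`,
`ProperSpace`), that the two-factor Dupuy–Hilado log-shell contains `R_I` but not `(R_I)^∼`.  This file
exhibits such a `K` inside Mathlib's `ℚ̄₃ = PadicAlgCl 3` (the literal setting "`k_i ⊆ ℚ̄_p` a finite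
extension of `ℚ_p`" of [IUTchIV] Prop. 1.1, p. 9, as packaged by abc-iut-S1's `PadicSubfields.lean`):
`E = ℚ₃⟮α⟯` for a cube root `α` of `3` (`ℚ̄₃` is algebraically closed), of degree EXACTLY `3` — `≤ 3`
because the minimal polynomial divides `X³ − 3`, `≥ 3` because `1, α, α²` are linearly independent
(`WildCubic.linearIndependent_one_pi_pi_sq`: distinct absolute values; no irreducibility argument is
needed).  Hence the obstruction is NOT vacuous: `exists_wild_packet_not_normalizedPacket_subset_logShell`.

Classical; proof-only (theorems, no definitions); nothing here takes a side on [IUTchIII] Cor. 3.12.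
[cite: Mochizuki2012, IUTchIV Prop. 1.1 p. 9, Prop. 1.2 (ii) p. 10] [cite: DupuyHilado2025, §4 (intro)]
[cite: NeukirchANT1999, Ch. II (5.5)]
-/

noncomputable section

namespace Literature.IUT.LogVolume

open Polynomial IntermediateField

/-- **A wildly ramified cubic subfield of `ℚ̄₃`**: there are `E ⊆ ℚ̄₃`, finite over `ℚ₃` with
`[E : ℚ₃] = 3`, and `π ∈ E` with `π³ = 3`. [cite: Mochizuki2012, IUTchIV Prop. 1.1 p. 9] -/
theorem exists_wildCubic_subfield :
    ∃ (E : IntermediateField ℚ_[3] (PadicAlgCl 3)) (π : E), FiniteDimensional ℚ_[3] E ∧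
      Module.finrank ℚ_[3] E = 3 ∧ π ^ 3 = 3 := by
  obtain ⟨α, hα⟩ := IsAlgClosed.exists_pow_nat_eq (3 : PadicAlgCl 3) (by norm_num : 0 < 3)
  have h3 : algebraMap ℚ_[3] (PadicAlgCl 3) 3 = 3 := map_ofNat _ 3
  have heval : Polynomial.aeval α (X ^ 3 - C (3 : ℚ_[3])) = 0 := by
    simp [hα, h3]
  have hint : IsIntegral ℚ_[3] α := ⟨X ^ 3 - C 3, monic_X_pow_sub_C 3 (by norm_num), by
    simpa [Polynomial.aeval_def] using heval⟩
  haveI hfd : FiniteDimensional ℚ_[3] ℚ_[3]⟮α⟯ := adjoin.finiteDimensional hint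
  have hπE : (⟨α, mem_adjoin_simple_self ℚ_[3] α⟩ : ℚ_[3]⟮α⟯) ^ 3 = 3 := by
    apply Subtype.ext
    have h3E : ((3 : ℚ_[3]⟮α⟯) : PadicAlgCl 3) = 3 := map_ofNat (algebraMap ℚ_[3]⟮α⟯ (PadicAlgCl 3)) 3
    simp [hα, h3E]
  refine ⟨ℚ_[3]⟮α⟯, ⟨α, mem_adjoin_simple_self ℚ_[3] α⟩, hfd, le_antisymm ?_ ?_, hπE⟩
  · rw [adjoin.finrank hint]
    have hdvd : minpoly ℚ_[3] α ∣ X ^ 3 - C 3 := minpoly.dvd ℚ_[3] α heval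
    have hne : (X ^ 3 - C (3 : ℚ_[3])) ≠ 0 := (monic_X_pow_sub_C 3 (by norm_num)).ne_zero
    calc (minpoly ℚ_[3] α).natDegree ≤ (X ^ 3 - C (3 : ℚ_[3])).natDegree := natDegree_le_of_dvd hdvd hne
      _ = 3 := natDegree_X_pow_sub_C
  · have hli := WildCubic.linearIndependent_one_pi_pi_sq (K := ℚ_[3]⟮α⟯) hπE
    simpa using hli.fintype_card_le_finrank

/-- **NON-VACUITY OF THE WILD-SHELL OBSTRUCTION**: for some finite `E ⊆ ℚ̄₃` (namely `ℚ₃(∛3)`), the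
two-factor packet `E ⊗_{ℚ₃} E` has `R_I ⊆ I_{v⃗}` and `(R_I)^∼ ⊄ I_{v⃗} = (2·3)^{−2}·log₃(R_I^×)` — with all
four instances of the cell's setting inferred (`ProperSpace` from `properSpace_subfield`).
[cite: Mochizuki2012, IUTchIV Prop. 1.2 (ii) p. 10] [cite: DupuyHilado2025, §4 (intro)] -/
theorem exists_wild_packet_not_normalizedPacket_subset_logShell :
    ∃ (E : IntermediateField ℚ_[3] (PadicAlgCl 3)) (_ : FiniteDimensional ℚ_[3] E),
      (integerPacket 3 (fun _ : Fin 2 => (E : Type)) : Set (PacketAlgebra 3 (fun _ : Fin 2 => (E : Type)))) ⊆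
          logShell 3 (fun _ : Fin 2 => (E : Type)) ∧
        ¬ ((normalizedPacket 3 (fun _ : Fin 2 => (E : Type)) :
            Set (PacketAlgebra 3 (fun _ : Fin 2 => (E : Type)))) ⊆ logShell 3 (fun _ : Fin 2 => (E : Type))) := by
  obtain ⟨E, π, hfd, hK, hπ⟩ := exists_wildCubic_subfield
  exact ⟨E, hfd, not_normalizedPacket_subset_logShell hK hπ⟩

end Literature.IUT.LogVolume

end
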